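import Summits.CriticalPhenomena.Ising3DConformalLimit.Theorems.EnergyNotSigmaSquaredGapForcesFarMergingSandwichFourToTwoAuxDictionary
import Summits.CriticalPhenomena.Ising3DConformalLimit.Theorems.IsingEuclidUpgradeR4NonGaussianSecondMomentBox
import Literature.Probability.LatticeModels.IntersectionSecondMoment
import Literature.Probability.LatticeModels.CurrentsPartialMonotonicity
import Literature.Probability.LatticeModels.SourcedDoubleCurrentsSwitching
import HarnessLib

/-!
# Crux `WindowForcesU4` (stmt-CriticalPhenomena-5505), line `registered`: stub A1
# `stub_meetSecondMomentBox` (Aizenman–Duminil-Copin 2021, Lemma 4.4: the second-moment inequality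
# for the DUPLICATED-MEETING event)

In the free box `Λ_n ⊂ ℤ³` at `β_c(3)`, for a quadruple `y` of box sites and a counting region
`A ⊆ Λ_n`: `M₁²/M₂ ≤ meet n y`, where `meet n y = P^{y₀y₁,∅} ⊗ P^{y₂y₃,∅}_{Λ_n}[C_{n₁+n₂}(y₀) ∩
C_{n₃+n₄}(y₂) ≠ ∅]` is the duplicated hitting probability of the line's Defs module, and
`M₁ = boxMoment₁`, `M₂ = boxMoment₂` are the moments of crux 0636's Defs module — the step
`P[N ≠ 0] ≥ E[N]²/E[N²]` of M. Aizenman, H. Duminil-Copin, Ann. of Math. **194** (2021) =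
arXiv:1912.07973, §4.2, proof of Lemma 4.4, for the number `N` of sites of `A` in
`C_{n₁+n₃}(y₀) ∩ C_{n₂+n₄}(y₂)` under two INDEPENDENT sourced double currents with source pairs
`{y₀,y₁}`, `{y₂,y₃}`. This is the landed template `stub_secondMomentBox`
(`Theorems/IsingEuclidUpgradeR4NonGaussianSecondMomentBox`, crux 0636) with its conclusion event
`FourMeet` (`y₀ ↔ y₂` in the sum of the four currents) replaced by an ARBITRARY event `S` of the four
currents containing every configuration whose two clusters `C_{n₁+n₃}(y₀)`, `C_{n₂+n₄}(y₂)` share a box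
vertex — instantiated at the pull-back of `Meet y` under the pair of lifted traces
(`meet_eq_fourCurrentLaw_real_preimage`, `mem_preimage_meet_of_not_disjoint` of the dictionary file
`Theorems/EnergyNotSigmaSquaredGapForcesFarMergingSandwichFourToTwoAuxDictionary`).
§1: the un-normalised steps on any finite graph (first moment by switching, second moment by ADC
Prop. A.3, `{N ≠ 0} ⊆ {the two clusters share a vertex of A}`); §2: transport to the box measures
(`P^{A,∅}_{Λ_L}{p} = w(p)/(Z[A]Z[∅])`, product measures of sets on countable discrete spaces are series,
`G_L(x,y) = Z[xy]/Z[∅]`), Cauchy–Schwarz, degenerate normalisers by `x/0 = 0`.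
Everything is proved; no definition and no named fact is introduced. Reference: ADC21 §3.1–3.2, (3.13),
§4.2 (Lemma 4.4), App. A.2 (Prop. A.3) [AizenmanDuminilCopinAnnals2021].
-/

noncomputable section

open Filter Topology MeasureTheory Finset
open Literature.Probability.LatticeModels Literature.Probability.Percolation
open scoped symmDiff ENNReal
open Summit.CriticalPhenomena.Ising3DConformalLimit.GapForcesFarMergingSandwich (meet Meet fourTraceLaw βc)
open Summit.CriticalPhenomena.Ising3DConformalLimit.Cruxes.IsingEuclidUpgradeR4NonGaussian.FreeCovarianceDeltaDichotomy
  (boxMoment₁ boxMoment₂ boxG threePointRatio twoStep fourCurrentLaw FourMeet fourCurrentMeet)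
open Summit.CriticalPhenomena.Ising3DConformalLimit.EnergyNotSigmaSquaredGapForcesFarMergingSandwich.FourToTwoProof
  (meet_eq_fourCurrentLaw_real_preimage mem_preimage_meet_of_not_disjoint)

namespace Summit.CriticalPhenomena.Ising3DConformalLimit.LatticeSDPCertificatesWindowForcesU4.MeetSecondMomentBoxProof

/-! ## §1. The un-normalised second-moment steps for DISJOINT source pairs -/

section Unnormalised

variable {V : Type*} [Fintype V] [DecidableEq V] {G : SimpleGraph V} [DecidableRel G.Adj]
  {K : G.edgeFinset → ℝ}

open Current

-- adapted from Theorems/IsingEuclidUpgradeR4NonGaussianSecondMomentBox.lean (`tsum_pairProd_mul_mul`, private there)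
/-- Fubini for the disjoint-pair product weight against a product function. [folklore] -/
private theorem tsum_pairProd_mul_mul (K : G.edgeFinset → ℝ) (a b c e : V)
    (f g : Current G × Current G → ℝ≥0∞) :
    ∑' pq : (Current G × Current G) × (Current G × Current G),
        epairWeight K ({a} ∆ {b}) ∅ pq.1 * epairWeight K ({c} ∆ {e}) ∅ pq.2 * (f pq.1 * g pq.2) =
      (∑' p, epairWeight K ({a} ∆ {b}) ∅ p * f p) * ∑' q, epairWeight K ({c} ∆ {e}) ∅ q * g q := by
  rw [tsum_mul_tsum_eq_tsum_prod]
  exact tsum_congr fun pq => by ring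

-- adapted from Theorems/IsingEuclidUpgradeR4NonGaussianSecondMomentBox.lean (`tsum_pairProd_mul_count`, private there)
/-- First moment of the intersection count of `C_{n₁+n₃}(a)` and `C_{n₂+n₄}(c)` in `A`, un-normalised
(disjoint source pairs): `∑ W N = ∑_{v ∈ A} (Z[bv] Z[av]) · (Z[ev] Z[cv])`.
[cite: AizenmanDuminilCopinAnnals2021, §4.2, proof of Lemma 4.4 (first moment of |𝓜|)] -/
private theorem tsum_pairProd_mul_count (hK : ∀ e, 0 ≤ K e) (A : Finset V) (a b c e : V) :
    ∑' pq : (Current G × Current G) × (Current G × Current G),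
        epairWeight K ({a} ∆ {b}) ∅ pq.1 * epairWeight K ({c} ∆ {e}) ∅ pq.2 *
          (∑ v ∈ A, connInd v a pq.1 * connInd v c pq.2) =
      ∑ v ∈ A, (ecurrentSum K ({b} ∆ {v}) * ecurrentSum K ({a} ∆ {v})) *
        (ecurrentSum K ({e} ∆ {v}) * ecurrentSum K ({c} ∆ {v})) := by
  simp_rw [Finset.mul_sum]
  rw [Summable.tsum_finsetSum (fun _ _ => ENNReal.summable)]
  refine Finset.sum_congr rfl fun v _ => ?_
  rw [tsum_pairProd_mul_mul K a b c e (connInd v a) (connInd v c)]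
  unfold connInd
  rw [tsum_epairWeight_mul_indicator_mem_cluster hK a b v,
    tsum_epairWeight_mul_indicator_mem_cluster hK c e v]

-- adapted from Theorems/IsingEuclidUpgradeR4NonGaussianSecondMomentBox.lean
-- (`sq_mul_tsum_pairProd_mul_count_sq_le`, private there)
/-- Second moment of the intersection count, un-normalised (Proposition A.3 twice):
`Z[∅]² ∑ W N² ≤ ∑_{v,w ∈ A} B_{ab}(v,w) B_{ce}(v,w)`.
[cite: AizenmanDuminilCopinAnnals2021, §4.2, proof of Lemma 4.4 (second moment of |𝓜|)] -/
private theorem sq_mul_tsum_pairProd_mul_count_sq_le (hK : ∀ e, 0 ≤ K e) (A : Finset V)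
    (a b c e : V) :
    ecurrentSum K ∅ ^ 2 *
        ∑' pq : (Current G × Current G) × (Current G × Current G),
          epairWeight K ({a} ∆ {b}) ∅ pq.1 * epairWeight K ({c} ∆ {e}) ∅ pq.2 *
            (∑ v ∈ A, connInd v a pq.1 * connInd v c pq.2) ^ 2 ≤
      ∑ v ∈ A, ∑ w ∈ A, twoStepBound K a b v w * twoStepBound K c e v w := by
  have hexp : ∀ pq : (Current G × Current G) × (Current G × Current G),
      epairWeight K ({a} ∆ {b}) ∅ pq.1 * epairWeight K ({c} ∆ {e}) ∅ pq.2 *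
          (∑ v ∈ A, connInd v a pq.1 * connInd v c pq.2) ^ 2 =
        ∑ v ∈ A, ∑ w ∈ A, epairWeight K ({a} ∆ {b}) ∅ pq.1 * epairWeight K ({c} ∆ {e}) ∅ pq.2 *
          ((connInd v a pq.1 * connInd w a pq.1) * (connInd v c pq.2 * connInd w c pq.2)) := by
    intro pq
    rw [sq, Finset.sum_mul_sum, Finset.mul_sum]
    refine Finset.sum_congr rfl fun v _ => ?_
    rw [Finset.mul_sum]
    exact Finset.sum_congr rfl fun w _ => by ring
  rw [tsum_congr hexp, Summable.tsum_finsetSum (fun _ _ => ENNReal.summable), Finset.mul_sum]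
  refine Finset.sum_le_sum fun v _ => ?_
  rw [Summable.tsum_finsetSum (fun _ _ => ENNReal.summable), Finset.mul_sum]
  refine Finset.sum_le_sum fun w _ => ?_
  rw [tsum_pairProd_mul_mul K a b c e (fun p => connInd v a p * connInd w a p)
    (fun q => connInd v c q * connInd w c q)]
  calc ecurrentSum K ∅ ^ 2 *
        ((∑' p, epairWeight K ({a} ∆ {b}) ∅ p * (connInd v a p * connInd w a p)) *
          ∑' q, epairWeight K ({c} ∆ {e}) ∅ q * (connInd v c q * connInd w c q))
      = (ecurrentSum K ∅ * ∑' p, epairWeight K ({a} ∆ {b}) ∅ p * (connInd v a p * connInd w a p)) *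
          (ecurrentSum K ∅ *
            ∑' q, epairWeight K ({c} ∆ {e}) ∅ q * (connInd v c q * connInd w c q)) := by ring
    _ ≤ twoStepBound K a b v w * twoStepBound K c e v w :=
        mul_le_mul' (ecurrentSum_empty_mul_tsum_connInd_mul_connInd_le hK a b v w)
          (ecurrentSum_empty_mul_tsum_connInd_mul_connInd_le hK c e v w)

/-- If the intersection count of `A` is nonzero, the two clusters `C_{q₁+q₂}(c)` and `C_{p₁+p₂}(a)`
share a vertex (of `A`). [folklore] -/
private theorem not_disjoint_of_count_ne_zero (A : Finset V) (a c : V)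
    (pq : (Current G × Current G) × (Current G × Current G))
    (h : (∑ v ∈ A, connInd v a pq.1 * connInd v c pq.2) ≠ 0) :
    ¬ Disjoint ((pq.2.1 + pq.2.2).cluster c) ((pq.1.1 + pq.1.2).cluster a) := by
  obtain ⟨v, -, hv⟩ := Finset.exists_ne_zero_of_sum_ne_zero h
  unfold connInd at hv
  have hva : v ∈ (pq.1.1 + pq.1.2).cluster a := by
    by_contra h'; exact hv (by rw [if_neg h', zero_mul])
  have hvc : v ∈ (pq.2.1 + pq.2.2).cluster c := by
    by_contra h'; exact hv (by rw [if_neg h', mul_zero])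
  exact fun hd => Finset.disjoint_left.1 hd hvc hva

end Unnormalised

/-! ## §2a. Product measures on countable discrete spaces -/

-- adapted from Theorems/IsingEuclidUpgradeR4NonGaussianSecondMomentBox.lean (`prod_apply_eq_tsum`, private there)
/-- The product measure of a set on countable discrete spaces, as a series over points. [folklore] -/
private theorem prod_apply_eq_tsum {α γ : Type*} [MeasurableSpace α] [MeasurableSpace γ]
    [Countable α] [Countable γ] [MeasurableSingletonClass α] [MeasurableSingletonClass γ]
    (μ : Measure α) (ν : Measure γ) [SFinite ν] (S : Set (α × γ)) :
    μ.prod ν S = ∑' pq : α × γ, μ {pq.1} * ν {pq.2} * S.indicator 1 pq := by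
  classical
  have hS : MeasurableSet S := S.to_countable.measurableSet
  rw [Measure.prod_apply hS, lintegral_countable', ENNReal.tsum_prod']
  refine tsum_congr fun p => ?_
  rw [← Measure.tsum_indicator_apply_singleton ν (Prod.mk p ⁻¹' S)
    (Set.to_countable _).measurableSet, ← ENNReal.tsum_mul_right]
  refine tsum_congr fun q => ?_
  by_cases h : (p, q) ∈ S
  · rw [Set.indicator_of_mem (show q ∈ Prod.mk p ⁻¹' S from h), Set.indicator_of_mem h,
      Pi.one_apply, mul_one, mul_comm]
  · rw [Set.indicator_of_notMem (show q ∉ Prod.mk p ⁻¹' S from h), Set.indicator_of_notMem h,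
      mul_zero, zero_mul]

/-! ## §2b. Transport to the free box `Λ_L ⊂ ℤ³` at `β_c(3)` -/

section Box

-- adapted from Theorems/IsingEuclidUpgradeR4NonGaussianSecondMomentBox.lean (`boxG_eq_div`, private there)
/-- The free box two-point function at `β_c` as a ratio of `ℝ≥0∞` current sums of the free box graph,
`G_L(x,y) = Z[{x}∆{y}]/Z[∅]` (random-current representation). [folklore] -/
private theorem boxG_eq_div (L : ℕ) (x y : BoxVertex 3 L) (hx : (x : Site 3) ∈ box 3 L)
    (hy : (y : Site 3) ∈ box 3 L) :
    boxG L x y =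
      (ecurrentSum (fun _ : (freeBoxGraph 3 L).edgeFinset => criticalBeta 3) ({x} ∆ {y})).toReal /
        (ecurrentSum (fun _ : (freeBoxGraph 3 L).edgeFinset => criticalBeta 3) ∅).toReal := by
  unfold boxG
  exact isingTwoPoint_free_box_eq_toReal_div L (criticalBeta_nonneg 3) x y hx hy

-- adapted from Theorems/IsingEuclidUpgradeR4NonGaussianSecondMomentBox.lean (`boxMoment₁_sq_le`, private
-- there), with the event `FourMeet` replaced by an arbitrary event `S` containing `{the clusters meet}`
/-- **The second-moment inequality in the free box, cross-multiplied, for any event containing the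
meeting of the two clusters** (Aizenman–Duminil-Copin 2021, Lemma 4.4 with disjoint source pairs): for box
vertices `a, b, c, e ∈ Λ_L` with `G_L(a,b) ≠ 0`, `G_L(c,e) ≠ 0`, `A ⊆ Λ_L`, and every set `S` of
four-current configurations containing all `(p, q)` whose clusters `C_{p₁+p₂}(a)`, `C_{q₁+q₂}(c)` share a
vertex, `M₁² ≤ (P^{ab,∅} ⊗ P^{ce,∅})[S] · M₂`.
[cite: AizenmanDuminilCopinAnnals2021, §4.2, proof of Lemma 4.4] -/
private theorem boxMoment₁_sq_le_real (L : ℕ) (a b c e : BoxVertex 3 L) (ha : (a : Site 3) ∈ box 3 L)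
    (hb : (b : Site 3) ∈ box 3 L) (hc : (c : Site 3) ∈ box 3 L) (he : (e : Site 3) ∈ box 3 L)
    (A : Finset (Site 3)) (hA : A ⊆ box 3 L) (hab : boxG L a b ≠ 0) (hce : boxG L c e ≠ 0)
    (S : Set ((Current (freeBoxGraph 3 L) × Current (freeBoxGraph 3 L)) ×
      (Current (freeBoxGraph 3 L) × Current (freeBoxGraph 3 L))))
    (hS : ∀ p q : Current (freeBoxGraph 3 L) × Current (freeBoxGraph 3 L),
      ¬ Disjoint ((q.1 + q.2).cluster c) ((p.1 + p.2).cluster a) → (p, q) ∈ S) :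
    boxMoment₁ L a b c e A ^ 2 ≤ (fourCurrentLaw L a b c e).real S * boxMoment₂ L a b c e A := by
  classical
  have hβ : 0 ≤ criticalBeta 3 := criticalBeta_nonneg 3
  set K : (freeBoxGraph 3 L).edgeFinset → ℝ := fun _ => criticalBeta 3 with hKdef
  have hK : ∀ e', 0 ≤ K e' := fun _ => hβ
  set Z : Finset (BoxVertex 3 L) → ℝ≥0∞ := ecurrentSum K with hZdef
  have hZtop : ∀ S, Z S ≠ ∞ := fun S => ecurrentSum_ne_top hK S
  have hZ0 : Z ∅ ≠ 0 := ecurrentSum_empty_ne_zero K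
  -- the box two-point functions as ratios; nondegeneracy; positivity of the partition functions
  have hG : ∀ x y : BoxVertex 3 L, (x : Site 3) ∈ box 3 L → (y : Site 3) ∈ box 3 L →
      boxG L x y = (Z ({x} ∆ {y})).toReal / (Z ∅).toReal :=
    fun x y hx hy => boxG_eq_div L x y hx hy
  have hZab : Z ({a} ∆ {b}) ≠ 0 := fun h =>
    hab (by rw [hG a b ha hb, h, ENNReal.toReal_zero, zero_div])
  have hZce : Z ({c} ∆ {e}) ≠ 0 := fun h =>
    hce (by rw [hG c e hc he, h, ENNReal.toReal_zero, zero_div])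
  have hr0 : 0 < (Z ∅).toReal := ENNReal.toReal_pos hZ0 (hZtop _)
  have hrab : 0 < (Z ({a} ∆ {b})).toReal := ENNReal.toReal_pos hZab (hZtop _)
  have hrce : 0 < (Z ({c} ∆ {e})).toReal := ENNReal.toReal_pos hZce (hZtop _)
  have hcs : ∀ S, Z S ≠ 0 → currentSum (freeBoxGraph 3 L) (criticalBeta 3) S ≠ 0 := fun S hS => by
    rw [currentSum_eq_wcurrentSum, ← toReal_ecurrentSum hK]
    exact (ENNReal.toReal_pos hS (hZtop S)).ne'
  -- the normaliser `R = Z[ab] Z[∅] Z[ce] Z[∅]` (real)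
  set R : ℝ := (Z ({a} ∆ {b})).toReal * (Z ∅).toReal * ((Z ({c} ∆ {e})).toReal * (Z ∅).toReal)
    with hRdef
  have hRpos : 0 < R := mul_pos (mul_pos hrab hr0) (mul_pos hrce hr0)
  -- sums over `A` as sums over box vertices
  set A' : Finset (BoxVertex 3 L) := boxSources 3 L A with hA'def
  have hsumA : ∀ f : Site 3 → ℝ, ∑ v ∈ A, f v = ∑ v ∈ A', f (v : Site 3) := fun f =>
    sum_eq_sum_boxSources L (hA.trans (box_subset_box_succ 3 L)) f
  have hA'box : ∀ v ∈ A', (v : Site 3) ∈ box 3 L := fun v hv => hA (mem_boxSources_iff.1 hv)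
  -- the un-normalised weight `W` of `P^{ab,∅} ⊗ P^{ce,∅}` and the intersection count `N`
  set W : (Current (freeBoxGraph 3 L) × Current (freeBoxGraph 3 L)) ×
      (Current (freeBoxGraph 3 L) × Current (freeBoxGraph 3 L)) → ℝ≥0∞ :=
    fun pq => epairWeight K ({a} ∆ {b}) ∅ pq.1 * epairWeight K ({c} ∆ {e}) ∅ pq.2 with hWdef
  set N : (Current (freeBoxGraph 3 L) × Current (freeBoxGraph 3 L)) ×
      (Current (freeBoxGraph 3 L) × Current (freeBoxGraph 3 L)) → ℝ≥0∞ :=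
    fun pq => ∑ v ∈ A', Current.connInd v a pq.1 * Current.connInd v c pq.2 with hNdef
  -- §1: (i) first moment, (iv) `{N ≠ 0} ⊆ S`, and the chain (iii) Cauchy–Schwarz + (ii) Prop. A.3
  have h1 : ∑' pq, W pq * N pq =
      ∑ v ∈ A', (Z ({b} ∆ {v}) * Z ({a} ∆ {v})) * (Z ({e} ∆ {v}) * Z ({c} ∆ {v})) :=
    tsum_pairProd_mul_count hK A' a b c e
  have h4 : ∀ pq, (if N pq = 0 then (0 : ℝ≥0∞) else 1) ≤ S.indicator 1 pq := by
    rintro ⟨p, q⟩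
    by_cases hN : N (p, q) = 0
    · rw [if_pos hN]; exact bot_le
    · rw [if_neg hN, Set.indicator_of_mem (hS p q (not_disjoint_of_count_ne_zero A' a c (p, q) hN)),
        Pi.one_apply]
  have hchain : (∑' pq, W pq * N pq) ^ 2 * Z ∅ ^ 2 ≤
      (∑' pq, W pq * S.indicator 1 pq) *
        ∑ v ∈ A', ∑ w ∈ A', Current.twoStepBound K a b v w * Current.twoStepBound K c e v w :=
    calc (∑' pq, W pq * N pq) ^ 2 * Z ∅ ^ 2
        ≤ ((∑' pq, W pq * (if N pq = 0 then 0 else 1)) * ∑' pq, W pq * N pq ^ 2) * Z ∅ ^ 2 :=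
          mul_le_mul' (Current.tsum_mul_sq_le_tsum_indicator_mul_tsum_sq W N) le_rfl
      _ = (∑' pq, W pq * (if N pq = 0 then 0 else 1)) * (Z ∅ ^ 2 * ∑' pq, W pq * N pq ^ 2) := by
          ring
      _ ≤ _ := mul_le_mul' (ENNReal.tsum_le_tsum fun pq => mul_le_mul' le_rfl (h4 pq))
          (sq_mul_tsum_pairProd_mul_count_sq_le hK A' a b c e)
  -- finiteness, and the real form of the chain
  have hWsum : ∑' pq, W pq = Z ({a} ∆ {b}) * Z ∅ * (Z ({c} ∆ {e}) * Z ∅) := by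
    rw [hZdef, ← tsum_epairWeight, ← tsum_epairWeight, tsum_mul_tsum_eq_tsum_prod]
  have hZt : Z ({a} ∆ {b}) * Z ∅ * (Z ({c} ∆ {e}) * Z ∅) ≠ ∞ :=
    ENNReal.mul_ne_top (ENNReal.mul_ne_top (hZtop _) (hZtop _))
      (ENNReal.mul_ne_top (hZtop _) (hZtop _))
  have hT0top : (∑' pq, W pq * S.indicator 1 pq) ≠ ∞ := by
    refine ne_top_of_le_ne_top hZt ?_
    rw [← hWsum]
    exact ENNReal.tsum_le_tsum fun pq => mul_le_of_le_one_right' (Set.indicator_le_self _ _ pq)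
  have htsb : ∀ o x v w : BoxVertex 3 L, Current.twoStepBound K o x v w ≠ ∞ := fun o x v w =>
    ENNReal.add_ne_top.2
      ⟨ENNReal.mul_ne_top (ENNReal.mul_ne_top (hZtop _) (hZtop _)) (hZtop _),
        ENNReal.mul_ne_top (ENNReal.mul_ne_top (hZtop _) (hZtop _)) (hZtop _)⟩
  have hBBtop : ∀ v ∈ A', ∑ w ∈ A', Current.twoStepBound K a b v w * Current.twoStepBound K c e v w ≠
      ∞ := fun v _ => ENNReal.sum_ne_top.2 fun w _ => ENNReal.mul_ne_top (htsb _ _ _ _) (htsb _ _ _ _)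
  have hreal : (∑' pq, W pq * N pq).toReal ^ 2 * (Z ∅).toReal ^ 2 ≤
      (∑' pq, W pq * S.indicator 1 pq).toReal *
        (∑ v ∈ A', ∑ w ∈ A', Current.twoStepBound K a b v w * Current.twoStepBound K c e v w).toReal :=
    by
    rw [← ENNReal.toReal_pow, ← ENNReal.toReal_pow, ← ENNReal.toReal_mul, ← ENNReal.toReal_mul]
    exact ENNReal.toReal_mono (ENNReal.mul_ne_top hT0top (ENNReal.sum_ne_top.2 hBBtop)) hchain
  -- §2: the four-current law, `P⁴[S] · R = (∑ W 𝟙[S]).toReal`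
  haveI : IsProbabilityMeasure
      (doubleCurrentMeasure (freeBoxGraph 3 L) (criticalBeta 3) ({a} ∆ {b}) ∅) :=
    isProbabilityMeasure_doubleCurrentMeasure_holds _ hβ (hcs _ hZab) (hcs _ hZ0)
  haveI : IsProbabilityMeasure
      (doubleCurrentMeasure (freeBoxGraph 3 L) (criticalBeta 3) ({c} ∆ {e}) ∅) :=
    isProbabilityMeasure_doubleCurrentMeasure_holds _ hβ (hcs _ hZce) (hcs _ hZ0)
  have hP4 : fourCurrentLaw L a b c e S =
      (∑' pq, W pq * S.indicator 1 pq) / (Z ({a} ∆ {b}) * Z ∅ * (Z ({c} ∆ {e}) * Z ∅)) := by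
    rw [fourCurrentLaw, boxSources_pair, boxSources_pair, prod_apply_eq_tsum, div_eq_mul_inv,
      ← ENNReal.tsum_mul_right]
    refine tsum_congr fun pq => ?_
    rw [doubleCurrentMeasure_singleton_eq_div _ _ hβ _ _ (hcs _ hZab) (hcs _ hZ0),
      doubleCurrentMeasure_singleton_eq_div _ _ hβ _ _ (hcs _ hZce) (hcs _ hZ0),
      ENNReal.mul_inv (Or.inl (mul_ne_zero hZab hZ0))
        (Or.inl (ENNReal.mul_ne_top (hZtop _) (hZtop _))), div_eq_mul_inv, div_eq_mul_inv]
    ring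
  have hP4r : (fourCurrentLaw L a b c e).real S * R = (∑' pq, W pq * S.indicator 1 pq).toReal := by
    rw [measureReal_def, hP4, ENNReal.toReal_div, ENNReal.toReal_mul, ENNReal.toReal_mul,
      ENNReal.toReal_mul]
    exact div_mul_cancel₀ _ hRpos.ne'
  -- §2: `M₁ · R = (∑ W N).toReal` and `M₂ · Z[∅]² R = (∑∑ B_{ab} B_{ce}).toReal`
  have hM1 : boxMoment₁ L a b c e A * R = (∑' pq, W pq * N pq).toReal := by
    rw [h1, ENNReal.toReal_sum (fun v _ => ENNReal.mul_ne_top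
      (ENNReal.mul_ne_top (hZtop _) (hZtop _)) (ENNReal.mul_ne_top (hZtop _) (hZtop _))),
      boxMoment₁, hsumA, Finset.sum_mul]
    refine Finset.sum_congr rfl fun v hv => ?_
    have hvb := hA'box v hv
    rw [ENNReal.toReal_mul, ENNReal.toReal_mul, ENNReal.toReal_mul, threePointRatio,
      threePointRatio, hG a v ha hvb, hG v b hvb hb, hG a b ha hb, hG c v hc hvb, hG v e hvb he,
      hG c e hc he, symmDiff_comm ({v} : Finset (BoxVertex 3 L)) {b},
      symmDiff_comm ({v} : Finset (BoxVertex 3 L)) {e}]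
    field_simp
    rw [hRdef]
    ring
  have hM2 : boxMoment₂ L a b c e A * ((Z ∅).toReal ^ 2 * R) =
      (∑ v ∈ A', ∑ w ∈ A', Current.twoStepBound K a b v w * Current.twoStepBound K c e v w).toReal :=
    by
    rw [ENNReal.toReal_sum hBBtop, boxMoment₂, hsumA, Finset.sum_mul]
    refine Finset.sum_congr rfl fun v hv => ?_
    have hvb := hA'box v hv
    rw [ENNReal.toReal_sum (fun w _ => ENNReal.mul_ne_top (htsb _ _ _ _) (htsb _ _ _ _)), hsumA,
      Finset.sum_mul]
    refine Finset.sum_congr rfl fun w hw => ?_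
    have hwb := hA'box w hw
    have h3top : ∀ s t u : Finset (BoxVertex 3 L), Z s * Z t * Z u ≠ ∞ := fun s t u =>
      ENNReal.mul_ne_top (ENNReal.mul_ne_top (hZtop _) (hZtop _)) (hZtop _)
    rw [ENNReal.toReal_mul, Current.twoStepBound, Current.twoStepBound,
      ENNReal.toReal_add (h3top _ _ _) (h3top _ _ _), ENNReal.toReal_add (h3top _ _ _) (h3top _ _ _)]
    simp only [ENNReal.toReal_mul]
    rw [twoStep, twoStep, hG a v ha hvb, hG v w hvb hwb, hG w b hwb hb, hG a w ha hwb, hG w v hwb hvb,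
      hG v b hvb hb, hG a b ha hb, hG c v hc hvb, hG w e hwb he, hG c w hc hwb, hG v e hvb he,
      hG c e hc he]
    field_simp
    rw [hRdef]
    ring
  -- conclusion: clear the positive factor `Z[∅]² R²`
  refine le_of_mul_le_mul_right ?_ (mul_pos (pow_pos hr0 2) (pow_pos hRpos 2))
  calc boxMoment₁ L a b c e A ^ 2 * ((Z ∅).toReal ^ 2 * R ^ 2)
      = (boxMoment₁ L a b c e A * R) ^ 2 * (Z ∅).toReal ^ 2 := by ring
    _ ≤ ((fourCurrentLaw L a b c e).real S * R) * (boxMoment₂ L a b c e A * ((Z ∅).toReal ^ 2 * R)) :=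
        by rw [hM1, hP4r, hM2]; exact hreal
    _ = (fourCurrentLaw L a b c e).real S * boxMoment₂ L a b c e A * ((Z ∅).toReal ^ 2 * R ^ 2) := by
        ring

end Box

/-! ## §3. The registered stub -/

/-- **Registered stub `stub_meetSecondMomentBox`** (stub A1 of line `registered` of crux
stmt-CriticalPhenomena-5505; Aizenman–Duminil-Copin 2021, Lemma 4.4, second-moment step, for the
DUPLICATED-MEETING event): in the free box `Λ_n ⊂ ℤ³` at `β_c(3)`, for a quadruple `y` of box sites and a
counting region `A ⊆ Λ_n`, the duplicated hitting probability
`meet n y = P^{y₀y₁,∅} ⊗ P^{y₂y₃,∅}_{Λ_n}[C_{n₁+n₂}(y₀) ∩ C_{n₃+n₄}(y₂) ≠ ∅]` dominates `M₁²/M₂`, where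
`M₁ = boxMoment₁ = E[N_A]` (exactly, by the switching lemma) and `M₂ = boxMoment₂ ≥ E[N_A²]` (Prop. A.3)
for the number `N_A` of sites of `A` common to the two clusters, by Cauchy–Schwarz
`E[N]² ≤ P[N ≠ 0] E[N²]` and `{N_A ≠ 0} ⊆ Meet` (a common site of `A` IS a shared vertex; the event is
read on the four currents through `meet_eq_fourCurrentLaw_real_preimage` and
`mem_preimage_meet_of_not_disjoint`); degenerate normalisers hold by `x/0 = 0`.
[cite: AizenmanDuminilCopinAnnals2021, §4.2 Lemma 4.4 and Appendix A Prop. A.3] -/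
theorem stub_meetSecondMomentBox :
    ∀ (n : ℕ) (y : Fin 4 → Site 3), (∀ i, y i ∈ box 3 n) →
      ∀ A : Finset (Site 3), A ⊆ box 3 n →
        boxMoment₁ n (y 0) (y 1) (y 2) (y 3) A ^ 2 / boxMoment₂ n (y 0) (y 1) (y 2) (y 3) A ≤
          meet n y := by
  intro n y hy A hA
  have hP : 0 ≤ meet n y := measureReal_nonneg
  by_cases hdeg : boxG n (y 0) (y 1) = 0 ∨ boxG n (y 2) (y 3) = 0
  · have hM1 : boxMoment₁ n (y 0) (y 1) (y 2) (y 3) A = 0 := by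
      refine Finset.sum_eq_zero fun v _ => ?_
      rcases hdeg with h | h
      · rw [threePointRatio, h, div_zero, zero_mul]
      · rw [threePointRatio, threePointRatio, h, div_zero, mul_zero]
    rw [hM1, zero_pow two_ne_zero, zero_div]
    exact hP
  push Not at hdeg
  suffices hmain : boxMoment₁ n (y 0) (y 1) (y 2) (y 3) A ^ 2 ≤
      meet n y * boxMoment₂ n (y 0) (y 1) (y 2) (y 3) A by
    rcases le_or_gt (boxMoment₂ n (y 0) (y 1) (y 2) (y 3) A) 0 with h0 | h0
    · rw [div_eq_mul_inv]
      exact (mul_nonpos_of_nonneg_of_nonpos (sq_nonneg _) (inv_nonpos.2 h0)).trans hP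
    · exact (div_le_iff₀ h0).2 hmain
  -- the four sources as box vertices (`Λ_n ⊆ Λ_{n+1}`), definitionally equal to `y i` after coercion
  set a : BoxVertex 3 n := ⟨y 0, box_subset_box_succ 3 n (hy 0)⟩ with ha
  set b : BoxVertex 3 n := ⟨y 1, box_subset_box_succ 3 n (hy 1)⟩ with hb
  set c : BoxVertex 3 n := ⟨y 2, box_subset_box_succ 3 n (hy 2)⟩ with hc
  set e : BoxVertex 3 n := ⟨y 3, box_subset_box_succ 3 n (hy 3)⟩ with he
  rw [meet_eq_fourCurrentLaw_real_preimage]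
  exact boxMoment₁_sq_le_real n a b c e (hy 0) (hy 1) (hy 2) (hy 3) A hA hdeg.1 hdeg.2
    (Prod.map (sourcedTrace 3 n) (sourcedTrace 3 n) ⁻¹' Meet y)
    fun p q hpq => mem_preimage_meet_of_not_disjoint a c rfl rfl p q hpq

end Summit.CriticalPhenomena.Ising3DConformalLimit.LatticeSDPCertificatesWindowForcesU4.MeetSecondMomentBoxProof

end
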